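import Literature.Analysis.FluidPDE.HeatKernelParabolicBounds
import HarnessLib

/-!
# Prop. 13.4 of Lemarié-Rieusset 2016: the heat-kernel part proved, the multiplier part vendored

Analysis/FluidPDE file in the decomposition of the named fact
`Literature.Analysis.FluidPDE.LemarieRieusset2016.prop13_4` (`ParabolicHeatPotentials.lean`:
Lemarié-Rieusset 2016, Prop. 13.4 p. 464 — for `f ∈ ℳ₂^{p,q₀}`, `g ∈ ℳ₂^{p,q₁}`,
`1/q₀ = 2/5 - α/5`, `1/q₁ = 1/5 - α/5`, the function `∫₀ᵗ W_{ν(t-s)} * (f + σ(D)g) ds` is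
parabolic-Hölder of exponent `α`), towards `LemarieRieusset2016.lemma13_6`.

* `LemarieRieusset2016.heatPotential_holder_of_morrey` — **proved**: the `f`-part. For
  `f ∈ ℳ₂^{p,q}` on `ℝ × ℝ³`, `1 ≤ p`, `5/2 < q < 5`, measurable, the heat potential
  `heatPotential ν (1_{s>0} f) = ∫₀ᵗ W_{ν(t-s)} * f(s) ds` is parabolic-Hölder of exponent
  `2 - 5/q` on `ℝ × ℝ³`: the abstract theorem `parabolicHolderOnWith_integral_of_kernel_bounds`
  (`ParabolicSingularPotentials.lean`) with `m = 3`, `d = 5(1 - 1/q)`, fed with the kernel bounds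
  `|W₊|ρ₂³ ≤ G₃`, `|W₊(z) - W₊(z-z')|ρ₂(z)⁴ ≤ Aρ₂(z')` and the absolute convergence of
  `HeatKernelParabolicBounds.lean`, and the `L¹`-Morrey bound `exists_morrey_one_bound`.
* `LemarieRieusset2016.prop13_4_multiplierPart` — **named fact**: the `σ(D)g`-part of Prop. 13.4
  as printed (same hypotheses as `prop13_4`, conclusion for `g` alone). Its kernel `σ(D)W₊` jumps
  across `t = 0` off the origin for a general symbol (`σ(D)δ ≠ 0` there), so it is not an instance
  of the abstract theorem; see the Scope paragraph of `ParabolicSingularPotentials.lean`.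
* `LemarieRieusset2016.prop13_4_of_multiplierPart : prop13_4_multiplierPart → prop13_4` —
  **proved** (the two parts add; `1/q₀ = 2/5 - α/5` with `0 < α < 1` gives `5/2 < q₀ < 5` and
  `2 - 5/q₀ = α`).

## References

* P. G. Lemarié-Rieusset, *The Navier–Stokes Problem in the 21st Century*, CRC Press (2016),
  Prop. 13.4 and its proof, pp. 464–465. [LemarieRieusset2016]
-/

noncomputable section

open MeasureTheory Set Function Filter Metric
open scoped NNReal ENNReal

namespace Literature.Analysis.FluidPDE

/-- Local notation for physical space `ℝ³ = EuclideanSpace ℝ (Fin 3)`. -/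
local notation "ℝ³" => EuclideanSpace ℝ (Fin 3)

namespace LemarieRieusset2016

/-! ### The heat-kernel part of Prop. 13.4 -/

/-- **Prop. 13.4, heat-kernel part, proved** (Lemarié-Rieusset 2016, Prop. 13.4 with `g = 0`,
p. 464): let `ν > 0`, `1 ≤ p`, `5/2 < q < 5`, and let `f ∈ ℳ₂^{p,q}` on `ℝ × ℝ³` be measurable.
Then `h = heatPotential ν (1_{s>0} f)`, i.e. `h(t, x) = ∫₀ᵗ W_{ν(t-s)} * f(s, ·) ds (x)` for `t > 0`
and `0` for `t ≤ 0`, is Hölderian of exponent `α = 2 - 5/q` with respect to the parabolic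
distance on `ℝ × ℝ³` (`1/q = 2/5 - α/5`). Proof: `parabolicHolderOnWith_integral_of_kernel_bounds`
with `m = 3`, `d = 5(1 - 1/q) ∈ (3, 4)`, the kernel bounds and absolute convergence of
`HeatKernelParabolicBounds.lean`, and `exists_morrey_one_bound`. [cite: LemarieRieusset2016, Prop. 13.4 p. 464] -/
theorem heatPotential_holder_of_morrey {ν p q : ℝ} {f : ℝ × ℝ³ → ℝ} (hν : 0 < ν) (hp : 1 ≤ p)
    (hq : 5 / 2 < q) (hq5 : q < 5) (hf : Measurable f)
    (hM : IsParabolicMorreyOn univ (fun w => ‖f w‖ₑ) p q) :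
    ∃ C : ℝ, ParabolicHolderOnWith C (2 - 5 / q)
      (heatPotential ν fun w => (((Ioi (0 : ℝ) ×ˢ (univ : Set ℝ³)).indicator f w : ℝ) : ℂ))
      univ := by
  have hq0 : 0 < q := by linarith
  set S : Set (ℝ × ℝ³) := Ioi (0 : ℝ) ×ˢ (univ : Set ℝ³) with hS
  have hSm : MeasurableSet S := measurableSet_Ioi.prod MeasurableSet.univ
  set F : ℝ × ℝ³ → ℂ := fun w => ((S.indicator f w : ℝ) : ℂ) with hF
  have hFm : Measurable F := Complex.measurable_ofReal.comp (hf.indicator hSm)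
  have hFle : ∀ w, ‖F w‖ₑ ≤ ‖f w‖ₑ := by
    intro w
    rw [hF]
    simp only
    rw [← ofReal_norm, ← ofReal_norm, Complex.norm_real]
    apply ENNReal.ofReal_le_ofReal
    by_cases hw : w ∈ S
    · rw [indicator_of_mem hw]
    · rw [indicator_of_notMem hw, norm_zero]
      exact norm_nonneg _
  have hMF : IsParabolicMorreyOn univ (fun w => ‖F w‖ₑ) p q :=
    hM.of_le MeasurableSet.univ (by linarith) fun w _ => hFle w
  obtain ⟨B, hB0, hB⟩ := exists_morrey_one_bound hp hFm.enorm.aemeasurable hMF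
  set d : ℝ := 5 * (1 - 1 / q) with hd
  have hd3 : 3 < d := by
    have : 1 / q < 2 / 5 := by rw [div_lt_div_iff₀ hq0 (by norm_num)]; linarith
    rw [hd]; linarith
  have hd4 : d < 3 + 1 := by
    have : 1 / 5 < 1 / q := by rw [div_lt_div_iff₀ (by norm_num) hq0]; linarith
    rw [hd]; linarith
  have hFT : ∀ w : ℝ × ℝ³, w.1 ≤ 0 → F w = 0 := by
    intro w hw
    have : w ∉ S := by
      rw [hS, mem_prod, mem_Ioi]
      exact fun h => absurd h.1 (not_lt.2 hw)
    simp [hF, indicator_of_notMem this]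
  -- the kernel
  set K : ℝ × ℝ³ → ℂ := fun z => ((heatKernelFwd ν z : ℝ) : ℂ) with hK
  have hKm : Measurable K := Complex.measurable_ofReal.comp (measurable_heatKernelFwd ν)
  have hK0 : K 0 = 0 := by simp [hK, heatKernelFwd_zero]
  set A : ℝ := max (gaussConst ν 3) (heatRegConst ν) with hA
  have hK1 : ∀ z, ‖K z‖ * parabolicNorm z ^ (3 : ℝ) ≤ A := fun z =>
    (heatKernelFwd_mul_parabolicNorm_pow_le hν z).trans (le_max_left _ _)
  have hK2 : ∀ z z' : ℝ × ℝ³, 2 * parabolicNorm z' ≤ parabolicNorm z →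
      ‖K z - K (z - z')‖ * parabolicNorm z ^ ((3 : ℝ) + 1) ≤ A * parabolicNorm z' := fun z z' h =>
    (heatKernelFwd_sub_mul_parabolicNorm_pow_le hν z z' h).trans
      (mul_le_mul_of_nonneg_right (le_max_right _ _) (parabolicNorm_nonneg _))
  have hint : ∀ z, Integrable (fun w => K (z - w) * F w) := fun z =>
    integrable_heatKernelFwd_mul hν hFm hB0 hd3 (by linarith) hFT hB z
  have H := parabolicHolderOnWith_integral_of_kernel_bounds hKm hFm hB0 (by norm_num : (0 : ℝ) < 3)
    hd3 hd4 hK0 hK1 hK2 hB hint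
  refine ⟨kernelHolderConst A B 3 d, ?_⟩
  have hexp : d - 3 = 2 - 5 / q := by rw [hd]; ring
  have hfun : (heatPotential ν F) = fun z => ∫ w, K (z - w) * F w := by
    funext z
    exact heatPotential_eq_integral_mul ν F z
  rw [hfun, ← hexp]
  exact H

/-! ### The multiplier part of Prop. 13.4 (named fact) and the assembly -/

/-- **Prop. 13.4, multiplier part** (Lemarié-Rieusset 2016, Prop. 13.4, p. 464, the term
`σ(D)g`). Let `ν > 0`, `1 ≤ p ≤ q₀ < q₁ < +∞` with `1/q₁ = 1/5 - α/5`, `1/q₀ = 2/5 - α/5`,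
`0 < α < 1`; let `σ` be a smooth function on `ℝ³ ∖ {0}`, homogeneous of exponent `1`, `σ(D)` the
Fourier multiplier with symbol `σ`; and let `g ∈ ℳ₂^{p,q₁}` on `ℝ × ℝ³` be measurable. Then
`h(t, x) = ∫₀ᵗ W_{ν(t-s)} * σ(D) g(s, ·) ds (x)` for `t > 0`, `0` for `t ≤ 0`, i.e.
`multiplierHeatPotential ν σ (1_{s>0} g)`, is Hölderian of exponent `α` for the parabolic
distance on `ℝ × ℝ³`. This is `prop13_4` with `f = 0`. The printed proof (p. 465) treats the
kernel `σ(D)W₊` like `W₊` through the bounds `|σ(D)W₊| ≤ Cρ₂⁻⁴`, `|∇σ(D)W₊| ≤ Cρ₂⁻⁵`,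
`|∂ₜσ(D)W₊| ≤ Cρ₂⁻⁶`; the last one holds for `t > 0` only — for a symbol that is not a
polynomial, `σ(D)W_{νt} → σ(D)δ ≠ 0` off the origin as `t ↓ 0`, so `1_{t>0}σ(D)W_{νt}` jumps
across `t = 0` — and the contribution of the thin slab `t - ρ₂(z₁ - z₂)² < s < t` has to be
estimated separately (by the mass of Morrey data in thin slabs); this part is therefore vendored
as printed rather than derived from `parabolicHolderOnWith_integral_of_kernel_bounds`. [cite: LemarieRieusset2016, Prop. 13.4 p. 464] -/
def prop13_4_multiplierPart : Prop :=
  ∀ (ν p q₀ q₁ α : ℝ) (σ : ℝ³ → ℂ) (g : ℝ × ℝ³ → ℝ),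
    0 < ν → 1 ≤ p → p ≤ q₀ → q₀ < q₁ → 1 / q₁ = 1 / 5 - α / 5 → 1 / q₀ = 2 / 5 - α / 5 →
    0 < α → α < 1 →
    ContDiffOn ℝ ((⊤ : ℕ∞) : WithTop ℕ∞) σ {0}ᶜ →
    (∀ c : ℝ, 0 < c → ∀ ξ : ℝ³, σ (c • ξ) = (c : ℂ) * σ ξ) →
    Measurable g →
    IsParabolicMorreyOn univ (fun w => ‖g w‖ₑ) p q₁ →
    ∃ C : ℝ, ParabolicHolderOnWith C α
      (multiplierHeatPotential ν σ ((Ioi (0 : ℝ) ×ˢ (univ : Set ℝ³)).indicator g)) univ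

/-- **Prop. 13.4 from its multiplier part** (Lemarié-Rieusset 2016, Prop. 13.4, p. 464): the
heat-kernel part is `heatPotential_holder_of_morrey` (with `q = q₀`: `1/q₀ = 2/5 - α/5` and
`0 < α < 1` give `5/2 < q₀ < 5` and `2 - 5/q₀ = α`), and parabolic-Hölder functions of the same
exponent add. [cite: LemarieRieusset2016, Prop. 13.4 p. 464] -/
theorem prop13_4_of_multiplierPart (h : prop13_4_multiplierPart) : prop13_4 := by
  intro ν p q₀ q₁ α σ f g hν hp hpq₀ hq₀q₁ h1 h0 hα0 hα1 hσ hhom hf hg hMf hMg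
  -- `q₀ ∈ (5/2, 5)` and `2 - 5/q₀ = α`
  have hq₀pos : 0 < q₀ := by
    by_contra hle
    have : 1 / q₀ ≤ 0 := one_div_nonpos.2 (not_lt.1 hle)
    linarith
  have h5 : 5 / q₀ = 2 - α := by
    rw [div_eq_mul_one_div 5 q₀, h0]
    ring
  have hq₀a : 5 / 2 < q₀ := by
    have : 5 / q₀ < 2 := by linarith
    rw [div_lt_iff₀ hq₀pos] at this
    linarith
  have hq₀b : q₀ < 5 := by
    have : 1 < 5 / q₀ := by linarith
    rw [lt_div_iff₀ hq₀pos] at this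
    linarith
  have hα : 2 - 5 / q₀ = α := by linarith
  obtain ⟨C₁, h₁⟩ := heatPotential_holder_of_morrey hν hp hq₀a hq₀b hf hMf
  rw [hα] at h₁
  obtain ⟨C₂, h₂⟩ := h ν p q₀ q₁ α σ g hν hp hpq₀ hq₀q₁ h1 h0 hα0 hα1 hσ hhom hg hMg
  exact ⟨C₁ + C₂, h₁.add h₂⟩

end LemarieRieusset2016

end Literature.Analysis.FluidPDE
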